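import Literature.AlgebraicGeometry.Frobenioids.UnitTrivializationModelComparisonBase
import HarnessLib

/-!
# Frobenioids I, Prop. 5.3: THE named comparison equivalence `C^un-tr ≌ untrModel F` and the base
# compatibility of the natural functor `ι : C^istr → C^rlf`

Mochizuki, *The geometry of Frobenioids I: the general theory*, Kyushu J. Math. **62** (2008) 293–400,
§5, Prop. 5.3 p. 103 ll. 16–30 [cite: MochizukiFrdI2008, Prop. 5.3 p.103] ("`C^un-tr` … may be obtained as
the model Frobenioid associated to … `Φ` … and … `Φ^birat`"; the 1-commutative diagram whose vertical
arrows `C^istr → C^un-tr → … → C^rlf` are "the natural functors"), Cor. 5.4 p. 104 l. 5 ("the vertical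
arrows are the natural functors of Proposition 5.3").

Companion of `UnitTrivializationModelComparison(Base).lean` (seat abc-iut-L1-d5: `exists_untr_comparison`,
`exists_untr_comparison_overBase` — EXISTENCE statements).  The rows C54/L06, C54/L08, C54/L09 and P53/L05c of the sub-DAG
`plan/L1/SUBDAG-FrdI-Prop53-Cor54.md` (seat abc-iut-w5-d137) are PARAMETRISED by an equivalence
`e : C^un-tr ≌ untrModel F`; this file NAMES one (a definition, by choice from the existence theorem —
Thm. 5.2 (iv)'s equivalence is itself built from a CHOSEN base-Frobenius pair, Def. 2.7 (iii)) and records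
its two compatibilities, so that those rows can be instantiated at THE constructions:

* `PreFrobenioid.untrComparison F hF : C^un-tr ≌ untrModel F` (DATA, `noncomputable def`);
* `untrComparison_compToElem` — `e ⋙ (untrModel F → F_Φ) ≅ (C^un-tr → F_Φ)` ("compatible with the
  functors to `F_Φ`");
* `toUntr_untrComparison_baseIso` — `C^istr → C^un-tr ≌ untrModel F → D` ≅ `C^istr ⊆ C → D` (the
  equivalence lies over `D`: the hypothesis of seat abc-iut-w5-d137's `FrdI.Prop53Sub.IotaRlfOverBase`);
* `FrdI.Prop53Sub.iotaRlf_untrComparison_baseIso` — THE `ι : C^istr → C^rlf` at `e := untrComparison F hF`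
  lies over `D` (row P53/L05c' `iotaRlfOverBase_holds`, `UnitTrivializationModelComparisonBase.lean`).

NOTE for consumers (row C54/L06, the 1-commutative square of Cor. 5.4): in `untrModel F` the rational
function monoid is `Φ^birat` with `Div_B` the INCLUSION `Φ^birat ↪ Φ^gp`, so relation (d) of Thm. 5.2 (i)
(`ModelFrobenioid.Hom.rel`) determines the unit coordinate of a morphism from its Frobenius degree, base
arrow, zero divisor and the classes of its source and target; the comparison functor therefore carries
no hidden unit-coordinate freedom, and rows stated over a binder `e` may be instantiated at this named
choice. (An earlier version of this docstring claimed a twist ambiguity `u ↦ u · χ(z)`; such a twist is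
NOT an endofunctor of `untrModel F` — it breaks relation (d) — and that claim is withdrawn.)

Honest framing: kernel bookkeeping for a 2008 published statement ([FrdI]); no new `Prop` is asserted (the
one `def` is DATA); nothing here bears on [IUTchIII] Cor. 3.12.  Seat abc-iut-L1-d5 (gen 3; filed by gen 4; v2 = docstring-only correction,
declarations byte-identical).
-/

noncomputable section

namespace Literature.AlgebraicGeometry.Frobenioids

open CategoryTheory Opposite

universe w v v' u u'

namespace PreFrobenioid

variable {D : Type u} [Category.{v} D] {Φ : Dᵒᵖ ⥤ CommMonCat.{w}}
  {C : Type u'} [Category.{v'} C] (F : C ⥤ ElemFrobenioid Φ)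

open PreFrobenioidData (ofFunctor)

/-- **THE comparison equivalence `C^un-tr ≌ untrModel F`** (Prop. 5.3 / Thm. 5.2 (iv) at `C^un-tr`): a
named choice from `exists_untr_comparison`. DATA. [cite: MochizukiFrdI2008, Prop. 5.3 p.103] -/
def untrComparison (hF : IsFrobenioid F) : (ofFunctor Φ F).Untr ≌ untrModel F :=
  haveI := (exists_untr_comparison F hF).choose_spec.1
  (exists_untr_comparison F hF).choose.asEquivalence

variable {F}

/-- The underlying functor of `untrComparison` is the chosen comparison functor.
[cite: MochizukiFrdI2008, Prop. 5.3 p.103] -/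
theorem untrComparison_functor (hF : IsFrobenioid F) :
    (untrComparison F hF).functor = (exists_untr_comparison F hF).choose := rfl

/-- **Compatibility with the functors to `F_Φ`**: `untrComparison ⋙ (untrModel F → F_Φ) ≅ (C^un-tr → F_Φ)`.
[cite: MochizukiFrdI2008, Prop. 5.3 p.103] -/
theorem untrComparison_compToElem (hF : IsFrobenioid F) :
    Nonempty ((untrComparison F hF).functor ⋙
        ModelFrobenioid.toElem Φ (biratSubfunctor F).toMonoid (biratSubfunctor F).incl ≅ untrFunctor hF) := by
  obtain ⟨e⟩ := (exists_untr_comparison F hF).choose_spec.2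
  exact ⟨e ≪≫ (untrFunctor hF).rightUnitor⟩

/-- **The comparison equivalence lies over `D`**: `C^istr → C^un-tr ≌ untrModel F → D` is isomorphic to
`C^istr ⊆ C → D` (from the compatibility with the functors to `F_Φ`, whose composite with `F_Φ → D` is the
base projection, and `C^istr → C^un-tr → F_Φ = C^istr ⊆ C → F_Φ` on the nose, Prop. 3.3 (iv)).
[cite: MochizukiFrdI2008, Prop. 5.3 p.103] -/
theorem toUntr_untrComparison_baseIso (hF : IsFrobenioid F) :
    Nonempty ((ofFunctor Φ F).toUntr ⋙ (untrComparison F hF).functor ⋙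
        ModelFrobenioid.baseFunctor Φ (biratSubfunctor F).toMonoid (biratSubfunctor F).incl ≅
      (ofFunctor Φ F).istrι ⋙ baseFunctor F) := by
  obtain ⟨e⟩ := untrComparison_compToElem hF
  exact toUntr_comp_baseIso_of_compToElem F hF _ e

end PreFrobenioid

/-! ### The natural functor `ι : C^istr → C^rlf` lies over `D` -/

namespace FrdI.Prop53Sub

variable {D : Type u} [Category.{v} D] {Φ : Dᵒᵖ ⥤ CommMonCat.{w}}
  {C : Type u'} [Category.{v'} C] (F : C ⥤ ElemFrobenioid Φ)

open PreFrobenioidData (ofFunctor)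

/-- **THE `ι : C^istr → C^rlf` lies over `D`** — at THE comparison equivalence `untrComparison F hF`,
unconditionally. [cite: MochizukiFrdI2008, Prop. 5.3 p.103] -/
theorem iotaRlf_untrComparison_baseIso (hF : PreFrobenioid.IsFrobenioid F)
    (hΦ : PreFrobenioid.IsPerfFactorialOn Φ) :
    Nonempty (iotaRlf F hΦ (PreFrobenioid.untrComparison F hF) ⋙ ModelFrobenioid.baseFunctor _ _ _ ≅
      (ofFunctor Φ F).istrι ⋙ PreFrobenioid.baseFunctor F) :=
  iotaRlfOverBase_holds F hΦ _ (PreFrobenioid.toUntr_untrComparison_baseIso hF)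

end FrdI.Prop53Sub

end Literature.AlgebraicGeometry.Frobenioids

end
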